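import Summits.HodgeConjecture.HodgeConjecture.Theorems.F0P3cStCharTSTracePairing      -- (this seat) ED. 2: `index_centralizer_subgroupOf_normalizer_ne_zero_of_injective` (the Weyl group of a regular element is finite)
import Literature.NumberTheory.Rogawski1990.TypeThreeCubicTorusNonsplit               -- ★ p851001 (g22): `isRegularElt_iff_separable_localNonsplitEquiv` (the one-place model `U(Φ₃)(L⁺_v) ≃ U(σ_w, Φ₃)(L_w) ≤ GL₃(L_w)`)
import Literature.NumberTheory.Rogawski1990.CMLocalAPacketMembers                      -- ★ `Gqs L v = U(Φ₃)(L⁺_v)`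
import HarnessLib

/-!
# F0 · P3c · line LH6 «StCharTS» — «WEYL-FIN★»: the Weyl group `N(Z(γ₀)) ∕ Z(γ₀)` of a REGULAR `γ₀ ∈ U(Φ₃)(L⁺_v)` is FINITE
# (the in-house half of the datum field `weylF T := |Ω_F(T, G)|` of the Weyl integration formula) [Rogawski1990, §3.5 p. 28; §12.5 p. 182]

Cell `pub/hodgecm-mathlib`, crux H413 = `stmt-HodgeConjecture-24833` (lane `--supports … --as helper`), route HCCMUnconditional; seat F0P3a-p03 (g23); census-first default
«WEYL-FIN★» (datum road of the (S-𝔇) organ, map owner LH6-p01 (g4), PLAN S9 §1 D6; announced 2026-09-02T12:46Z).  THEOREMS ONLY (no definition ∕ instance ∕ notation ∕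
named fact ∕ `sorry`); ★-only imports.

WHAT.  The carpets `WeylIntegrationFormula` ∕ `StableWeylIntegrationFormula` of the §12.5 datum (★ `Ch12Sec5`) weight each Cartan representative `T` by `(𝔇.weylF T)⁻¹`,
print's `|Ω_F(T, G)|⁻¹` with `Ω_F(T, G) = N_G(T)(F) ∕ T(F)` [§3.5 p. 28].  For the constructor to put `weylF (Z γ₀) :=` the index of `Z(γ₀)` in its normaliser, that index
must be a genuine positive integer.  This file proves it on the organ's carrier `Gqs L v = U(Φ₃)(L⁺_v)` at a NON-SPLIT place `v`:
* **`index_centralizer_subgroupOf_normalizer_ne_zero`** — for every REGULAR `γ₀ : Gqs L v`, `((Z(γ₀)).subgroupOf N(Z(γ₀))).index ≠ 0`, i.e. `N(Z(γ₀)) ∕ Z(γ₀)` is finite: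
  the generic ★ `F0P3cStCharTSTracePairing.index_centralizer_subgroupOf_normalizer_ne_zero_of_injective` (any group with a faithful `N`-dimensional representation, any
  element with separable characteristic polynomial: `n ↦ n γ₀ n⁻¹` maps `N(Z(γ₀))` into the FINITE set of elements of `L_w[γ₀]` with the characteristic polynomial of `γ₀`,
  fibres = cosets of `Z(γ₀)`) applied to the injective one-place homomorphism `U(Φ₃)(L⁺_v) ≃ U(σ_w, Φ₃)(L_w) ≤ GL₃(L_w)` (★ `localNonsplitEquiv`);
* `index_centralizer_subgroupOf_normalizer_pos` — the same as `0 <`; `finite_normalizer_quotient_centralizer` — `Finite (N ⧸ Z)`.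
Print's VALUES of `|Ω_F(T, G)|` per type of `T` [§3.6 pp. 28–31] remain print (S9d); the split torus `M` has index `2` in-house (★ `WeylHypMeasure.index_torusU_subgroupOf_normalizer_eq_two`).
HONEST LABEL: HC_CM is proved only modulo the 7 printed citations (2 remaining named inputs: hLiu418 = `stmt-HodgeConjecture-24832`, h413 = `stmt-HodgeConjecture-24833`)
until rung 0 closes; this file closes no organ (count-neutral constructor-side asset).

## References
* [Rogawski1990] J. D. Rogawski, *Automorphic Representations of Unitary Groups in Three Variables*, Ann. of Math. Stud. 123 (1990): §3.5 p. 28 (`Ω_F(T, G)`); §3.6 pp. 28–31;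
  §12.5 p. 182 (the weights `|Ω_F(T, G)|⁻¹` of the Weyl integration formula).
* [HarishChandra1970] Harish-Chandra (notes by G. van Dijk), *Harmonic Analysis on Reductive p-adic Groups*, LNM 162 (1970), Lemma 42 (`W_A = Ã ∕ A` is finite).
-/

set_option autoImplicit false
-- the mandated namespace has the single-problem summit's repeated segment (`HodgeConjecture.HodgeConjecture`)
set_option linter.dupNamespace false

noncomputable section

open NumberField IsDedekindDomain
open scoped Matrix MatrixGroups
open Literature.NumberTheory.Rogawski1990 Literature.NumberTheory.Automorphic Literature.NumberTheory.Automorphic.UnitaryGroup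
open Literature.NumberTheory.Rogawski1990.TypeThreeTorus
open Summit.HodgeConjecture.HodgeConjecture.Cruxes.H413.F0P3cStCharTSTracePairing

namespace Summit.HodgeConjecture.HodgeConjecture.Cruxes.H413.F0P3cStCharTSWeylFinite

variable (L : Type) [Field L] [NumberField L] [IsCMField L] (v : HeightOneSpectrum (𝓞 ↥(maximalRealSubfield L)))

/-- **«WEYL-FIN★»: the Weyl group `N(Z(γ₀)) ∕ Z(γ₀)` of a REGULAR `γ₀ ∈ U(Φ₃)(L⁺_v)` is FINITE** (`v` non-split): the index of the centraliser in its normaliser is non-zero.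
Generic ★ `index_centralizer_subgroupOf_normalizer_ne_zero_of_injective` at the injective one-place homomorphism `U(Φ₃)(L⁺_v) ≃ U(σ_w, Φ₃)(L_w) ≤ GL₃(L_w)`
(★ `localNonsplitEquiv`), regularity read as separability there (★ `isRegularElt_iff_separable_localNonsplitEquiv`). [cite: Rogawski1990, §3.5 p. 28; §12.5 p. 182]
[cite: HarishChandra1970, Lemma 42] -/
theorem index_centralizer_subgroupOf_normalizer_ne_zero (hns : ∀ w : PlacesOver L v, IsCMField.complexConj L • w.1 = w.1) (γ₀ : Gqs L v)
    (hreg : IsRegularElt (γ₀.val : GL (Fin 3) (LocalRing L v))) :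
    ((Subgroup.centralizer ({γ₀} : Set (Gqs L v))).subgroupOf
      (Subgroup.normalizer ((Subgroup.centralizer ({γ₀} : Set (Gqs L v)) : Subgroup (Gqs L v)) : Set (Gqs L v)))).index ≠ 0 := by
  obtain ⟨w⟩ := (inferInstance : Nonempty (PlacesOver L v))
  have hw := hns w
  -- the faithful one-place representation `ρ = subtype ∘ e : U(Φ₃)(L⁺_v) →* GL₃(L_w)`
  let e := localNonsplitEquiv (IsCMField.complexConj L) (qsForm L) (IsCMField.complexConj_ne_one L) w hw
  let ρ : Gqs L v →* GL (Fin 3) (w.1.adicCompletion L) :=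
    (unitaryGroupOfForm (galAdicCompletionMap (L := L) (IsCMField.complexConj L) hw) (placeForm (qsForm L) w.1)).subtype.comp e.toMonoidHom
  have hρ : Function.Injective ρ := Subtype.val_injective.comp e.injective
  have hsep : (((ρ γ₀ : GL (Fin 3) (w.1.adicCompletion L))) : Matrix (Fin 3) (Fin 3) (w.1.adicCompletion L)).charpoly.Separable :=
    (isRegularElt_iff_separable_localNonsplitEquiv L w hw γ₀).1 hreg
  exact index_centralizer_subgroupOf_normalizer_ne_zero_of_injective ρ hρ γ₀ hsep

/-- `0 < [N(Z(γ₀)) : Z(γ₀)]` for a regular `γ₀ ∈ U(Φ₃)(L⁺_v)`, `v` non-split (the shape of a `weylF` field value). [cite: Rogawski1990, §3.5 p. 28; §12.5 p. 182] -/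
theorem index_centralizer_subgroupOf_normalizer_pos (hns : ∀ w : PlacesOver L v, IsCMField.complexConj L • w.1 = w.1) (γ₀ : Gqs L v)
    (hreg : IsRegularElt (γ₀.val : GL (Fin 3) (LocalRing L v))) :
    0 < ((Subgroup.centralizer ({γ₀} : Set (Gqs L v))).subgroupOf
      (Subgroup.normalizer ((Subgroup.centralizer ({γ₀} : Set (Gqs L v)) : Subgroup (Gqs L v)) : Set (Gqs L v)))).index :=
  Nat.pos_of_ne_zero (index_centralizer_subgroupOf_normalizer_ne_zero L v hns γ₀ hreg)

/-- **`N(Z(γ₀)) ∕ Z(γ₀)` is a FINITE type** for a regular `γ₀ ∈ U(Φ₃)(L⁺_v)`, `v` non-split. [cite: Rogawski1990, §3.5 p. 28] [cite: HarishChandra1970, Lemma 42] -/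
theorem finite_normalizer_quotient_centralizer (hns : ∀ w : PlacesOver L v, IsCMField.complexConj L • w.1 = w.1) (γ₀ : Gqs L v)
    (hreg : IsRegularElt (γ₀.val : GL (Fin 3) (LocalRing L v))) :
    Finite (↥(Subgroup.normalizer ((Subgroup.centralizer ({γ₀} : Set (Gqs L v)) : Subgroup (Gqs L v)) : Set (Gqs L v))) ⧸
      (Subgroup.centralizer ({γ₀} : Set (Gqs L v))).subgroupOf
        (Subgroup.normalizer ((Subgroup.centralizer ({γ₀} : Set (Gqs L v)) : Subgroup (Gqs L v)) : Set (Gqs L v)))) :=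
  (Subgroup.fintypeOfIndexNeZero (index_centralizer_subgroupOf_normalizer_ne_zero L v hns γ₀ hreg)).finite

end Summit.HodgeConjecture.HodgeConjecture.Cruxes.H413.F0P3cStCharTSWeylFinite

end
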